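import Literature.NumberTheory.Automorphic.LocalHermitianFormsRankThree
import Literature.NumberTheory.Automorphic.LocalUnitaryGroupCongr
import Literature.NumberTheory.Automorphic.Liu2021.LemD1DataOfPlace
import HarnessLib

/-!
# An ISOTROPIC hermitian plane over a local field is hyperbolic: `U(H)(F_v) ≃ₜ* U(Φ₂)(F_v)` at every finite place where `H_v` is isotropic

Topic `NumberTheory/Automorphic`; namespace `Literature.NumberTheory.Automorphic.UnitaryGroup`.  KERNEL ONLY: theorems, no definition,
no named fact, no instance, no notation, no `sorry`.  The RANK-2 companion of ★ `LocalHermitianFormsRankThree` (odd rank: every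
hermitian form at a non-split place is a unit multiple of the split form — which FAILS in rank 2 at the anisotropic places).

**Why (cell hodgecm-mathlib, director s454∕s465, F0P3a-plan (g3) RULING #68′).**  The `N`-generic quasi-split comparison letter T1g(N)
of the trace-formula engine has the shape «`v ∉ S`: a level-matching isomorphism `U(H)_v ≃ U(Φ_N)_v`» + «`v ∈ S`: a local inner-transfer
datum»; at `N = 2` the exceptional set contains the set `T` of finite places where the hermitian PLANE `H_v` is anisotropic (there
`U(H)(F_v)` is compact, ★ `compactSpace_cmDatum_local_of_not_isIsotropic`), and `T ≠ ∅` is forced for `[F:ℚ]` even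
(★ `Liu2021/RemD5CompanionParity.even_ncard_not_isIsotropic_iff`).  This file supplies the OTHER half on the tree's carriers: at every
finite place OUTSIDE `T` the local groups of `H` and of the split form `Φ₂ = antidiag(1,1)` are isomorphic.

**Results.**
* §1 (pure algebra, any field `K` with an involution `σ`): `exists_formCongr_eq_antidiag_two_of_hyperbolicPair` — a `σ`-hermitian
  `H ∈ M₂(K)` with a HYPERBOLIC PAIR (`h(r,r) = h(r',r') = 0`, `h(r,r') = 1`) satisfies `ᵗσ(T) · H · T = Φ₂` for the frame `T = (r, r')`
  ([Dieudonne1971GroupesClassiques, Chap. II §5]: an isotropic non-degenerate plane is hyperbolic; [Jacobowitz1962, §3]).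
* §2 (a NON-SPLIT finite place `v` of `F`, `w ∣ v`, `c • w = w`, so `E_v = E ⊗_F F_v` is a field): `exists_isUnit_formCongr_map_eq_smul_antidiag_two_of_isotropic`
  — if `H_v` is ISOTROPIC (`∃ r ≠ 0, h_v(r,r) = 0`; hyperbolic partner by ★ `exists_hyperbolic_partner_localGram`) then
  `ᵗ(c ⊗ 1)(T) · H_v · T = a • (Φ₂)_v` with `a = 1` — LITERALLY the non-split input `hns` of ★ `nonempty_cmDatum_local_equiv_antidiag_of_forall_nonsplit_formCongr`
  AT THAT PLACE; `isIsotropic_standingData_iff_localGram` identifies the hypothesis with `LemD1.IsIsotropic` of the tree's standing data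
  (the currency of ★ `even_ncard_not_isIsotropic_iff`).
* §3 (CM packaging, `F = L⁺`, `E = L`): **`nonempty_cmDatum_local_equiv_antidiag_two_of_isotropic`** — for `H ∈ M₂(L)` hermitian with
  `det H ≠ 0` and a finite place `v` of `L⁺` at which `H` is isotropic above every non-split `w ∣ v`:
  `Nonempty ((cmDatum L 2 H).Local v ≃ₜ* (cmDatum L 2 Φ₂).Local v)` (split places are free: ★ `cmDatumLocalSplitCongr`); and the
  anisotropic-global variant.  With ★ `eventually_exists_continuousMulEquiv_cmLocalIntegralLevel_iff` (level matching off a finite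
  set, rank-generic) this is the «`v ∉ S`» half of T1g(2).

References: [Dieudonne1971GroupesClassiques] J. Dieudonné, *La géométrie des groupes classiques*, 3e éd. (1971), Chap. II §5.
[Jacobowitz1962] R. Jacobowitz, *Hermitian forms over local fields*, Amer. J. Math. 84 (1962), §3.  [Rogawski1990] §3.8 p. 33 (the classes
of unitary groups in two variables ↔ `F^*/NE^*`), §14.2 p. 232.  [PlatonovRapinchuk1994] §2.3.
-/

set_option autoImplicit false

noncomputable section

open Matrix NumberField IsDedekindDomain

namespace Literature.NumberTheory.Automorphic.UnitaryGroup

/-! ## §1 Rank 2 over a field: a hyperbolic pair is a frame in which `H` is `Φ₂` -/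

section Field

variable {K : Type*} [Field K] (σ : K →+* K) (H : Matrix (Fin 2) (Fin 2) K)

/-- **An isotropic non-degenerate hermitian plane is hyperbolic** ([Dieudonne1971GroupesClassiques, Chap. II §5]; [Jacobowitz1962, §3]):
`σ` an involution of the field `K`, `H ∈ M₂(K)` `σ`-hermitian, `(r, r')` a hyperbolic pair (`h(r,r) = h(r',r') = 0`, `h(r,r') = 1`,
`h = hermForm σ H`).  Then `ᵗσ(T) · H · T = Φ₂ = antidiag(1,1)` for the frame `T = (r, r') ∈ GL₂(K)` (linearly independent because
`h(r, ·)` and `h(r', ·)` separate them). [cite: Dieudonne1971GroupesClassiques, Chap. II §5] [cite: Jacobowitz1962, §3 Thm. 3.1] -/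
theorem exists_formCongr_eq_antidiag_two_of_hyperbolicPair (hσ : ∀ s, σ (σ s) = s) (hH : (H.map σ)ᵀ = H)
    {r r' : Fin 2 → K} (hr : hermForm σ H r r = 0) (hr' : hermForm σ H r' r' = 0) (hrr' : hermForm σ H r r' = 1) :
    ∃ T : GL (Fin 2) K, formCongr σ T H = Matrix.of fun i j : Fin 2 => if i.val + j.val + 1 = 2 then (1 : K) else 0 := by
  classical
  have hr'r : hermForm σ H r' r = 1 := by rw [← conj_hermForm σ H hσ hH, hrr', map_one]
  -- the frame `(r, r')` is linearly independent
  have key : LinearIndependent K ![r, r'] := by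
    rw [Fintype.linearIndependent_iff]
    intro g hg
    rw [Fin.sum_univ_two] at hg
    simp only [Matrix.cons_val_zero, Matrix.cons_val_one] at hg
    have e1 := congrArg (hermForm σ H r) hg
    have e2 := congrArg (hermForm σ H r') hg
    simp only [hermForm_add_right, hermForm_smul_right, hermForm_zero_right, hr, hrr', hr'r, hr', mul_zero, mul_one,
      zero_add, add_zero] at e1 e2
    intro i
    fin_cases i
    · exact e2
    · exact e1
  have hA : IsUnit ((Matrix.of ![r, r'] : Matrix (Fin 2) (Fin 2) K)ᵀ) :=
    (Matrix.isUnit_transpose _).2 (Matrix.linearIndependent_rows_iff_isUnit.1 key)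
  refine ⟨hA.unit, ?_⟩
  ext i j
  rw [formCongr_apply_eq_hermForm_col, hA.unit_spec, Matrix.of_apply]
  change hermForm σ H (![r, r'] i) (![r, r'] j) = _
  fin_cases i <;> fin_cases j <;> simp [hr, hr', hrr', hr'r]

/-- The split form `Φ_N = antidiag(1, …, 1)`, written `(i, j) ↦ [i + j + 1 = N]`, is preserved entrywise by every ring homomorphism
(entries `0`, `1`). [folklore] -/
private theorem antidiag_map' {R R' : Type*} [NonAssocSemiring R] [NonAssocSemiring R'] (f : R →+* R') (N : ℕ) :
    (Matrix.of fun i j : Fin N => if i.val + j.val + 1 = N then (1 : R) else 0).map f =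
      Matrix.of fun i j : Fin N => if i.val + j.val + 1 = N then (1 : R') else 0 := by
  ext i j
  simp only [Matrix.map_apply, Matrix.of_apply, apply_ite f, map_one, map_zero]

end Field

/-! ## §2 At a non-split place where `H_v` is isotropic: `H_v ≃ Φ₂` -/

section Local

variable {F : Type} [Field F] [NumberField F] (E : Type) [Field E] [NumberField E] [Algebra F E]
  [Algebra.IsQuadraticExtension F E] (c : E ≃ₐ[F] E)

omit [NumberField E] in
/-- In a quadratic extension `E/F` with `c ≠ 1` there is `δ` with `c δ = -δ ≠ 0` (`δ = e - c e` for any `e` moved by `c`; `c² = 1`) —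
the parameter of the tree's place-wise standing data. [folklore] -/
private theorem exists_apply_eq_neg_ne_zero' (hc : c ≠ 1) : ∃ δ : E, c δ = -δ ∧ δ ≠ 0 := by
  haveI : FiniteDimensional F E :=
    Module.finite_of_finrank_eq_succ (Algebra.IsQuadraticExtension.finrank_eq_two F E)
  haveI : PerfectField F := inferInstance
  haveI : Algebra.IsAlgebraic F E := inferInstance
  haveI : Algebra.IsSeparable F E := inferInstance
  obtain ⟨e, he⟩ : ∃ e : E, c e ≠ e := by
    by_contra h
    push Not at h
    exact hc (AlgEquiv.ext h)
  refine ⟨e - c e, ?_, sub_ne_zero.mpr (Ne.symm he)⟩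
  rw [map_sub, neg_sub, ← AlgEquiv.mul_apply, algEquiv_mul_self_eq_one F hc, AlgEquiv.one_apply]

/-- **The isotropy hypothesis in the currency of the tree's standing data**: `LemD1.IsIsotropic` of [Liu2021, App. D §D.1]'s standing data
AT THE PLACE `v` (★ `Liu2021.LemD1OfPlace.standingData`) is, by definition, the existence of a non-zero isotropic vector of the local
Gram matrix `J_v = (J ⊗ 1)` for `h_v = hermForm (c ⊗ 1) J_v` — the hypothesis of §2–§3 below and the currency of
★ `Liu2021.RemD5CompanionParity.even_ncard_not_isIsotropic_iff`. [cite: Liu2021, App. D §D.1 and Lem. D.1 (4)] -/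
theorem isIsotropic_standingData_iff_localGram {N : ℕ} (J : Matrix (Fin N) (Fin N) E) (v : HeightOneSpectrum (𝓞 F))
    {δ : E} (hcδ : c δ = -δ) (hδ : δ ≠ 0) (hN : 2 ≤ N) (hJh : (J.map c)ᵀ = J) (hJdet : J.det ≠ 0) :
    Literature.NumberTheory.Automorphic.Liu2021.LemD1.IsIsotropic
        (Liu2021.LemD1OfPlace.standingData E v c N J hcδ hδ hN hJh hJdet) ↔
      ∃ r : Fin N → LocalRing E v, r ≠ 0 ∧ hermForm (conjLocal E c v) ((adelicForm E N J).map (adeleToLocal E v)) r r = 0 :=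
  Iff.rfl

/-- **At a non-split place an ISOTROPIC hermitian plane is the split form** ([Dieudonne1971GroupesClassiques, Chap. II §5]; the rank-2 case
of [Jacobowitz1962, Thm. 3.1]; [Rogawski1990, §3.8 p. 33]: `H′_ξ ≅ U(2)` quasi-split iff `ξ ∈ N(E_v^*)`): `c ≠ 1`, `H ∈ M₂(E)` `c`-hermitian
with `det H ≠ 0`, `w ∣ v` with `c • w = w` (so `E_v = E ⊗_F F_v` is a field, ★ `LocalRing.isField_of_smul_eq`), and `H_v` ISOTROPIC
(`∃ r ≠ 0, h_v(r, r) = 0`).  Then `ᵗ(c ⊗ 1)(T) · H_v · T = a • (Φ₂)_v` for some `T ∈ GL₂(E_v)` and a unit `a` (namely `a = 1`; hyperbolic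
partner by ★ `exists_hyperbolic_partner_localGram`, then §1) — the non-split input `hns` of ★
`nonempty_cmDatum_local_equiv_antidiag_of_forall_nonsplit_formCongr` AT THIS PLACE. [cite: Dieudonne1971GroupesClassiques, Chap. II §5]
[cite: Rogawski1990, §3.8 p. 33] -/
theorem exists_isUnit_formCongr_map_eq_smul_antidiag_two_of_isotropic (hc : c ≠ 1) (H : Matrix (Fin 2) (Fin 2) E)
    (hHh : (H.map c)ᵀ = H) (hHd : H.det ≠ 0) {v : HeightOneSpectrum (𝓞 F)} (w : PlacesOver E v) (hw : c • w.1 = w.1)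
    (hiso : ∃ r : Fin 2 → LocalRing E v, r ≠ 0 ∧ hermForm (conjLocal E c v) ((adelicForm E 2 H).map (adeleToLocal E v)) r r = 0) :
    ∃ (T : GL (Fin 2) (LocalRing E v)) (a : LocalRing E v), IsUnit a ∧
      formCongr (conjLocal E c v) T (H.map (algebraMap E (LocalRing E v))) =
        a • (Matrix.of fun i j : Fin 2 => if i.val + j.val + 1 = 2 then (1 : E) else 0).map (algebraMap E (LocalRing E v)) := by
  have hE : IsField (LocalRing E v) := LocalRing.isField_of_smul_eq c hc w hw
  obtain ⟨δ, hcδ, hδ⟩ := exists_apply_eq_neg_ne_zero' E c hc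
  obtain ⟨r, hr0, hr⟩ := hiso
  obtain ⟨r', hr', hrr'⟩ := exists_hyperbolic_partner_localGram E c 2 H v hcδ hδ hE hHh hHd hr hr0
  rw [adelicForm_map_adeleToLocal] at hr hr' hrr'
  have hHv : ((H.map (algebraMap E (LocalRing E v))).map (conjLocal E c v))ᵀ = H.map (algebraMap E (LocalRing E v)) := by
    rw [← adelicForm_map_adeleToLocal]; exact Liu2021.LemD1OfPlace.localGram_hermitian E v c 2 H hHh
  letI : Field (LocalRing E v) := hE.toField
  obtain ⟨T, hT⟩ := exists_formCongr_eq_antidiag_two_of_hyperbolicPair (conjLocal E c v) (H.map (algebraMap E (LocalRing E v)))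
    (Liu2021.LemD1OfPlace.conjLocal_conjLocal_apply E v c hcδ hδ) hHv hr hr' hrr'
  exact ⟨T, 1, isUnit_one, by rw [hT, one_smul, antidiag_map']⟩

end Local

/-! ## §3 The CM packaging: `U(H)(L⁺_v) ≃ₜ* U(Φ₂)(L⁺_v)` at every finite place where `H` is isotropic -/

section CM

variable (L : Type) [Field L] [NumberField L] [IsCMField L]

/-- **`U(H)(L⁺_v) ≃ₜ* U(Φ₂)(L⁺_v)` at a finite place `v` of `L⁺` outside the anisotropic set `T`.**  For `H ∈ M₂(L)` hermitian
(`ᵗ(H̄) = H`) with `det H ≠ 0` and a finite place `v` such that `H_v` is isotropic above every NON-SPLIT `w ∣ v` (no condition at split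
`v`: there both groups are `GL₂(L_w)`, ★ `cmDatumLocalSplitCongr`), the local unitary groups of `H` and of the split form
`Φ₂ = antidiag(1,1)` are isomorphic as topological groups (non-split: §2 + ★ `cmDatumLocalCongr`). [cite: Rogawski1990, §3.8 p. 33]
[cite: PlatonovRapinchuk1994, §2.3] -/
theorem nonempty_cmDatum_local_equiv_antidiag_two_of_isotropic (H : Matrix (Fin 2) (Fin 2) L)
    (hH : (H.map (cmConjRingHom L))ᵀ = H) (hHd : H.det ≠ 0) (v : HeightOneSpectrum (𝓞 ↥(maximalRealSubfield L)))
    (hiso : ∀ w : PlacesOver L v, IsCMField.complexConj L • w.1 = w.1 →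
      ∃ r : Fin 2 → LocalRing L v, r ≠ 0 ∧
        hermForm (conjLocal L (IsCMField.complexConj L) v) ((adelicForm L 2 H).map (adeleToLocal L v)) r r = 0) :
    Nonempty ((cmDatum L 2 H).Local v ≃ₜ*
      (cmDatum L 2 (Matrix.of fun i j : Fin 2 => if i.val + j.val + 1 = 2 then (1 : L) else 0)).Local v) := by
  obtain ⟨w⟩ : Nonempty (PlacesOver L v) := inferInstance
  by_cases hw : IsCMField.complexConj L • w.1 = w.1
  · obtain ⟨T, a, ha, h⟩ := exists_isUnit_formCongr_map_eq_smul_antidiag_two_of_isotropic L (IsCMField.complexConj L)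
      (IsCMField.complexConj_ne_one L) H ((map_cmConjRingHom_eq_map_complexConj L H) ▸ hH) hHd w hw (hiso w hw)
    exact ⟨(cmDatumLocalCongr L v T ha h).symm⟩
  · exact ⟨cmDatumLocalSplitCongr L hH (isUnit_iff_ne_zero.2 hHd) (antidiagOne_isHermitian L 2) (isUnit_antidiagOne_det L 2) w hw⟩

/-- The same for a globally ANISOTROPIC `H` (the binders of the compact unitary groups `U(H)` of the P5 letters; anisotropic ⇒ `det H ≠ 0`,
★ `Godement.det_ne_zero_of_anisotropic`), with the isotropy hypothesis phrased through the standing data of [Liu2021, App. D §D.1]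
(`LemD1.IsIsotropic`, the currency in which ★ `even_ncard_not_isIsotropic_iff` counts the anisotropic places `T`): at every finite
`v` with `H` isotropic above each non-split `w ∣ v`, `U(H)(L⁺_v) ≃ₜ* U(Φ₂)(L⁺_v)`. [cite: Rogawski1990, §3.8 p. 33] [cite: Liu2021, App. D Lem. D.1 (4)] -/
theorem nonempty_cmDatum_local_equiv_antidiag_two_of_isIsotropic (H : Matrix (Fin 2) (Fin 2) L)
    (hanis : ∀ x : Fin 2 → L, Literature.AlgebraicGeometry.ShimuraVarieties.hermForm (cmConjRingHom L) H x x = 0 → x = 0)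
    (hH : (H.map (cmConjRingHom L))ᵀ = H) {δ : L} (hcδ : IsCMField.complexConj L δ = -δ) (hδ : δ ≠ 0)
    (v : HeightOneSpectrum (𝓞 ↥(maximalRealSubfield L)))
    (hiso : ∀ w : PlacesOver L v, IsCMField.complexConj L • w.1 = w.1 →
      Literature.NumberTheory.Automorphic.Liu2021.LemD1.IsIsotropic
        (Liu2021.LemD1OfPlace.standingData L v (IsCMField.complexConj L) 2 H hcδ hδ le_rfl
          ((map_cmConjRingHom_eq_map_complexConj L H) ▸ hH) (Godement.det_ne_zero_of_anisotropic L H hanis))) :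
    Nonempty ((cmDatum L 2 H).Local v ≃ₜ*
      (cmDatum L 2 (Matrix.of fun i j : Fin 2 => if i.val + j.val + 1 = 2 then (1 : L) else 0)).Local v) :=
  nonempty_cmDatum_local_equiv_antidiag_two_of_isotropic L H hH (Godement.det_ne_zero_of_anisotropic L H hanis) v
    fun w hw => (isIsotropic_standingData_iff_localGram L (IsCMField.complexConj L) H v hcδ hδ le_rfl
      ((map_cmConjRingHom_eq_map_complexConj L H) ▸ hH) (Godement.det_ne_zero_of_anisotropic L H hanis)).1 (hiso w hw)

end CM

end Literature.NumberTheory.Automorphic.UnitaryGroup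

end
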